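import Summits.AtomisticToContinuum.HydrodynamicLimit.Theorems.HydroLimitInBand.Negative.ShearReduction
import Summits.AtomisticToContinuum.HydrodynamicLimit.Theorems.OneSphereInfluenceStaticScoreResponseGaussMoments
import HarnessLib

/-!
# `HydroLimitInBand` (crux stmt-AtomisticToContinuum-9133), negative side: GAUSSIAN STREAMING OF THE SHEAR

Standing disprover's lemmas (`Cruxes/HydroLimitInBand/Disproof.lean` §7–§8, refuter-cdisprove lineage of stmt-9133;
resubmission of p105012, which bounced only on a gate restart), inputs of the tightness of `0 < σ`
(`Negative/SigmaZero.lean`):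

* `integral_cos_mul_gaussianReal`, `integral_sin_mul_gaussianReal` — `E cos(aW) = e^{-a²/2}`, `E sin(aW) = 0` for
  `W ∼ N(0,1)` (real and imaginary parts of `charFun_gaussianReal`); their three-dimensional coordinate versions under
  `stdGaussian V3` (independent coordinates, `integral_stdGaussian_eq_pi` of the tree + `integral_pi3_prod`).
* `integral_shear_stream` — **the Gaussian streaming mean of the shear momentum observable**: for a particle of the local
  equilibrium `(1, sin(2π x₁) e₀, 1)` at `x`, the Maxwellian mean of `χ(x + t v) v₀`, `χ = sin(2π ·₁)`, is
  `e^{-2π² t²} sin²(2π x₁)` — the free-streaming (Knudsen) value, different from the Euler value `sin²(2π x₁)` for `t ≠ 0`.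
* `integral_shearProfile_sq` — `∫_{𝕋³} sin²(2π x₁) dx = 1/2` (the Euler value of the tested momentum field).
-/

noncomputable section

open MeasureTheory Filter Set Topology Function

namespace Summit.AtomisticToContinuum.HydrodynamicLimit.Theorems.HydroLimitInBandNegative

open Literature.MathematicalPhysics.KineticTheory Literature.Analysis.FluidPDE
open Literature.Analysis.FunctionSpaces

section GaussStream

open ProbabilityTheory Complex

/-- The characteristic function of `N(0,1)` at `a`, as a real number inside `ℂ`. [folklore] -/
theorem integral_cexp_gaussianReal (a : ℝ) :
    ∫ x : ℝ, cexp (a * x * I) ∂gaussianReal 0 1 = ((Real.exp (-(a ^ 2 / 2)) : ℝ) : ℂ) := by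
  have h := charFun_gaussianReal (μ := 0) (v := 1) a
  rw [charFun_apply_real] at h
  rw [h, Complex.ofReal_exp]
  congr 1
  push_cast
  ring

/-- The integrand of the characteristic function is integrable (it has norm `1`). [folklore] -/
theorem integrable_cexp_gaussianReal (a : ℝ) : Integrable (fun x : ℝ => cexp (a * x * I)) (gaussianReal 0 1) := by
  refine Integrable.of_bound (C := 1) (by fun_prop) (Eventually.of_forall fun x => ?_)
  rw [show (a : ℂ) * x * I = ((a * x : ℝ) : ℂ) * I by push_cast; ring, norm_exp_ofReal_mul_I]

/-- `E[cos (a W)] = exp(-a²/2)` for `W ∼ N(0,1)` (real part of the characteristic function). [folklore] -/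
theorem integral_cos_mul_gaussianReal (a : ℝ) :
    ∫ r, Real.cos (a * r) ∂gaussianReal 0 1 = Real.exp (-(a ^ 2 / 2)) := by
  have hre := congrArg RCLike.re (integral_cexp_gaussianReal a)
  rw [← integral_re (integrable_cexp_gaussianReal a)] at hre
  simp only [RCLike.re_to_complex, Complex.ofReal_re] at hre
  rw [← hre]
  refine integral_congr_ae (Eventually.of_forall fun x => ?_)
  show Real.cos (a * x) = (cexp (a * x * I)).re
  rw [show (a : ℂ) * x * I = ((a * x : ℝ) : ℂ) * I by push_cast; ring, exp_ofReal_mul_I_re]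

/-- `E[sin (a W)] = 0` for `W ∼ N(0,1)` (imaginary part of the characteristic function). [folklore] -/
theorem integral_sin_mul_gaussianReal (a : ℝ) : ∫ r, Real.sin (a * r) ∂gaussianReal 0 1 = 0 := by
  have him := congrArg RCLike.im (integral_cexp_gaussianReal a)
  rw [← integral_im (integrable_cexp_gaussianReal a)] at him
  simp only [RCLike.im_to_complex, Complex.ofReal_im] at him
  calc ∫ r, Real.sin (a * r) ∂gaussianReal 0 1 = ∫ x : ℝ, (cexp (a * x * I)).im ∂gaussianReal 0 1 :=
        integral_congr_ae (Eventually.of_forall fun x => by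
          show Real.sin (a * x) = (cexp (a * x * I)).im
          rw [show (a : ℂ) * x * I = ((a * x : ℝ) : ℂ) * I by push_cast; ring, exp_ofReal_mul_I_im])
    _ = 0 := him

/-- Product integrands over the three Gaussian coordinates factorise (Fubini). [folklore] -/
theorem integral_pi3_prod (f g k : ℝ → ℝ) :
    ∫ x : Fin 3 → ℝ, f (x 0) * g (x 1) * k (x 2) ∂Measure.pi (fun _ : Fin 3 => gaussianReal 0 1) =
      (∫ r, f r ∂gaussianReal 0 1) * (∫ r, g r ∂gaussianReal 0 1) * (∫ r, k r ∂gaussianReal 0 1) := by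
  have h := integral_fintype_prod_eq_prod (𝕜 := ℝ) (μ := fun _ : Fin 3 => gaussianReal 0 1)
    (fun i : Fin 3 => if i = 0 then f else if i = 1 then g else k)
  simp only [Fin.prod_univ_three] at h
  simpa using h

/-- The total mass of `N(0,1)` as a Bochner integral. [folklore] -/
theorem integral_one_gaussianReal : ∫ _ : ℝ, (1 : ℝ) ∂gaussianReal 0 1 = 1 := by simp

/-- `E[cos (a W₁)] = exp(-a²/2)` under the standard Gaussian on `ℝ³`. [folklore] -/
theorem integral_cos_coord_one_stdGaussian (a : ℝ) :
    ∫ w, Real.cos (a * w 1) ∂stdGaussian V3 = Real.exp (-(a ^ 2 / 2)) := by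
  rw [integral_stdGaussian_eq_pi (ι := Fin 3) (by fun_prop)]
  have h := integral_pi3_prod (fun _ => 1) (fun r => Real.cos (a * r)) (fun _ => 1)
  simp only [one_mul, mul_one, integral_one_gaussianReal, integral_cos_mul_gaussianReal] at h
  simpa using h

/-- `E[sin (a W₁)] = 0` under the standard Gaussian on `ℝ³`. [folklore] -/
theorem integral_sin_coord_one_stdGaussian (a : ℝ) : ∫ w, Real.sin (a * w 1) ∂stdGaussian V3 = 0 := by
  rw [integral_stdGaussian_eq_pi (ι := Fin 3) (by fun_prop)]
  have h := integral_pi3_prod (fun _ => 1) (fun r => Real.sin (a * r)) (fun _ => 1)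
  simp only [one_mul, mul_one, integral_one_gaussianReal, integral_sin_mul_gaussianReal] at h
  simpa using h

/-- `E[cos (a W₁) W₀] = 0` (independent coordinates, `E W₀ = 0`). [folklore] -/
theorem integral_cos_coord_one_mul_coord_zero_stdGaussian (a : ℝ) :
    ∫ w, Real.cos (a * w 1) * w 0 ∂stdGaussian V3 = 0 := by
  rw [integral_stdGaussian_eq_pi (ι := Fin 3) (by fun_prop)]
  have h := integral_pi3_prod (fun r => r) (fun r => Real.cos (a * r)) (fun _ => 1)
  simp only [mul_one, integral_one_gaussianReal, integral_id_gaussianReal, zero_mul] at h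
  simpa [mul_comm] using h

/-- `E[sin (a W₁) W₀] = 0` (independent coordinates, `E W₀ = 0`). [folklore] -/
theorem integral_sin_coord_one_mul_coord_zero_stdGaussian (a : ℝ) :
    ∫ w, Real.sin (a * w 1) * w 0 ∂stdGaussian V3 = 0 := by
  rw [integral_stdGaussian_eq_pi (ι := Fin 3) (by fun_prop)]
  have h := integral_pi3_prod (fun r => r) (fun r => Real.sin (a * r)) (fun _ => 1)
  simp only [mul_one, integral_one_gaussianReal, integral_id_gaussianReal, zero_mul] at h
  simpa [mul_comm] using h

end GaussStream

/-! ## The streaming mean of the shear momentum observable, and the shear's second moment -/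

section ShearStream

open ProbabilityTheory

/-- The coordinate `1` of a particle of the shear state does not see the shear: under free flight with velocity
`u(x) + w` it moves to `x₁ + t w₁`. [folklore] -/
theorem smul_shearVelocity_add_apply_one (x : T3) (t : ℝ) (w : V3) : (t • (shearVelocity x + w)) 1 = t * w 1 := by
  simp

/-- **The Gaussian streaming mean of the shear momentum observable.** For a particle of the local equilibrium
`(1, sin(2π x₁) e₀, 1)` sitting at `x`, the mean of `χ(x + t v) v₀`, `χ = sin(2π ·₁)`, over its Maxwellian velocity
`v ∼ N(u(x), id)` is `e^{-2π² t²} sin²(2π x₁)`: the shear modulation seen through a thermal displacement `t w₁` is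
damped by the Gaussian factor `E cos(2π t W) = e^{-2π²t²}` (characteristic function), and the fluctuation `w₀` is
independent and centred. This is the one-particle input of the free-streaming (Knudsen) value of the momentum
field, which differs from its Euler value `sin²(2π x₁)` for every `t ≠ 0`. [folklore] -/
theorem integral_shear_stream (t : ℝ) (x : T3) :
    ∫ v, shearProfile (x + Torus.proj (t • v)) * v 0 ∂gaussMeasure (shearVelocity x) 1 =
      Real.exp (-(2 * Real.pi ^ 2 * t ^ 2)) * shearProfile x ^ 2 := by
  rw [integral_gaussMeasure (shearVelocity x) one_pos]
  simp only [Real.sqrt_one, one_smul]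
  obtain ⟨y, hy⟩ := QuotientAddGroup.mk_surjective (x 1)
  have hs : shearProfile x = Real.sin (2 * Real.pi * y) := by
    rw [shearProfile, ← hy]; exact sinCircle_coe y
  set A := Real.sin (2 * Real.pi * y) with hA
  set B := Real.cos (2 * Real.pi * y) with hB
  set c := 2 * Real.pi * t with hc
  have hint : ∀ w : V3, shearProfile (x + Torus.proj (t • (shearVelocity x + w))) * (shearVelocity x + w) 0 =
      A * A * Real.cos (c * w 1) + A * B * Real.sin (c * w 1) + A * (Real.cos (c * w 1) * w 0) +
        B * (Real.sin (c * w 1) * w 0) := by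
    intro w
    have h1 : (shearVelocity x + w) 0 = A + w 0 := by simp [hs]
    have h2 : shearProfile (x + Torus.proj (t • (shearVelocity x + w))) = Real.sin (2 * Real.pi * (y + t * w 1)) := by
      have hcoord : (x + Torus.proj (t • (shearVelocity x + w))) 1 = (((y + t * w 1 : ℝ)) : UnitAddCircle) := by
        rw [Pi.add_apply, Torus.proj_apply, smul_shearVelocity_add_apply_one, ← hy, AddCircle.coe_add]
      rw [shearProfile, hcoord]
      exact sinCircle_coe _
    rw [h1, h2, show 2 * Real.pi * (y + t * w 1) = 2 * Real.pi * y + c * w 1 by rw [hc]; ring, Real.sin_add]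
    ring
  simp_rw [hint]
  -- integrability of the four pieces
  have hcos : Integrable (fun w : V3 => Real.cos (c * w 1)) (stdGaussian V3) :=
    Integrable.of_bound (C := 1) (by fun_prop) (Eventually.of_forall fun w => by
      rw [Real.norm_eq_abs]; exact Real.abs_cos_le_one _)
  have hsin : Integrable (fun w : V3 => Real.sin (c * w 1)) (stdGaussian V3) :=
    Integrable.of_bound (C := 1) (by fun_prop) (Eventually.of_forall fun w => by
      rw [Real.norm_eq_abs]; exact Real.abs_sin_le_one _)
  have hw0 : Integrable (fun w : V3 => w 0) (stdGaussian V3) :=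
    (memLp_coord_stdGaussian (0 : Fin 3) 2 (by simp)).integrable one_le_two
  have hcos0 : Integrable (fun w : V3 => Real.cos (c * w 1) * w 0) (stdGaussian V3) :=
    hw0.bdd_mul (c := 1) (by fun_prop) (Eventually.of_forall fun w => by
      rw [Real.norm_eq_abs]; exact Real.abs_cos_le_one _)
  have hsin0 : Integrable (fun w : V3 => Real.sin (c * w 1) * w 0) (stdGaussian V3) :=
    hw0.bdd_mul (c := 1) (by fun_prop) (Eventually.of_forall fun w => by
      rw [Real.norm_eq_abs]; exact Real.abs_sin_le_one _)
  have hL2 : Integrable (fun w : V3 => A * A * Real.cos (c * w 1) + A * B * Real.sin (c * w 1)) (stdGaussian V3) :=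
    (hcos.const_mul _).add (hsin.const_mul _)
  have hL3 : Integrable (fun w : V3 => A * A * Real.cos (c * w 1) + A * B * Real.sin (c * w 1) +
      A * (Real.cos (c * w 1) * w 0)) (stdGaussian V3) := hL2.add (hcos0.const_mul _)
  rw [integral_add hL3 (hsin0.const_mul B), integral_add hL2 (hcos0.const_mul A),
    integral_add (hcos.const_mul (A * A)) (hsin.const_mul (A * B)),
    integral_const_mul, integral_const_mul, integral_const_mul, integral_const_mul,
    integral_cos_coord_one_stdGaussian, integral_sin_coord_one_stdGaussian,
    integral_cos_coord_one_mul_coord_zero_stdGaussian, integral_sin_coord_one_mul_coord_zero_stdGaussian, hs]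
  rw [show -(c ^ 2 / 2) = -(2 * Real.pi ^ 2 * t ^ 2) by rw [hc]; ring]
  ring

/-- Integration over `𝕋³` of a function of the coordinate `1` is integration over the unit circle. [folklore] -/
theorem integral_T3_coord_one (F : UnitAddCircle → ℝ) (hF : Continuous F) :
    ∫ x : T3, F (x 1) = ∫ b : UnitAddCircle, F b := by
  have hmp : MeasurePreserving (fun x : T3 => x 1) volume (AddCircle.haarAddCircle (T := 1)) := by
    rw [Torus.volume_eq_pi_haarAddCircle]
    exact measurePreserving_eval (fun _ : Fin 3 => AddCircle.haarAddCircle (T := 1)) 1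
  have hvol : (volume : Measure UnitAddCircle) = AddCircle.haarAddCircle := by
    rw [AddCircle.volume_eq_smul_haarAddCircle]; simp
  calc ∫ x : T3, F (x 1) = ∫ b, F b ∂(Measure.map (fun x : T3 => x 1) volume) :=
        (integral_map ((measurable_pi_apply (1 : Fin 3) : Measurable fun x : T3 => x 1).aemeasurable)
          hF.aestronglyMeasurable).symm
    _ = ∫ b, F b ∂(AddCircle.haarAddCircle (T := 1)) := by rw [hmp.map_eq]
    _ = ∫ b, F b := by rw [hvol]

/-- `∫₀¹ sin²(2π a) da = 1/2`. [folklore] -/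
theorem intervalIntegral_sin_sq_two_pi : ∫ a in (0 : ℝ)..1, Real.sin (2 * Real.pi * a) ^ 2 = 1 / 2 := by
  have h := intervalIntegral.integral_comp_mul_left (fun u => Real.sin u ^ 2) (c := 2 * Real.pi)
    (Real.two_pi_pos.ne') (a := 0) (b := 1)
  rw [h, integral_sin_sq]
  simp [Real.sin_two_pi, Real.cos_two_pi]
  field_simp

/-- The circle profile `sin(2π ·)` is continuous. [folklore] -/
theorem continuous_sinCircle : Continuous sinCircle :=
  (by fun_prop : Continuous fun y : ℝ => Real.sin (2 * Real.pi * y)).quotient_liftOn' _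

/-- **The shear has mean square `1/2`**: `∫_{𝕋³} sin²(2π x₁) dx = 1/2`. [folklore] -/
theorem integral_shearProfile_sq : ∫ x : T3, shearProfile x ^ 2 = 1 / 2 := by
  have h1 : ∫ x : T3, shearProfile x ^ 2 = ∫ b : UnitAddCircle, sinCircle b ^ 2 :=
    integral_T3_coord_one (fun b => sinCircle b ^ 2) (continuous_sinCircle.pow 2)
  rw [h1, ← UnitAddCircle.intervalIntegral_preimage 0 (fun b => sinCircle b ^ 2)]
  simp only [sinCircle_coe, zero_add]
  exact intervalIntegral_sin_sq_two_pi

end ShearStream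

end Summit.AtomisticToContinuum.HydrodynamicLimit.Theorems.HydroLimitInBandNegative

end
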